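import Literature.Analysis.Fourier.StationaryPhase
import HarnessLib

/-!
# Stationary phase with three derivatives and the error `(λ₃/λ₂²) log` (between Titchmarsh's Lemma 4.6
# and Graham–Kolesnik's Lemma 3.4)

Topic `Literature/Analysis/Fourier`, sequel to `StationaryPhase.lean` (Titchmarsh's Lemma 4.6, whose
Fresnel machinery `fresnelS`, `fresnelLim`, `fresnelC = ∫_{-∞}^{∞} e^{iu²/2} du` is reused).  Everything here
is PROVED; no definitions besides the proof-local ones, no named facts.

Titchmarsh's Lemma 4.6 carries the error term `O(λ₂^{-4/5} λ₃^{1/5})`, coming from a cubic Taylor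
expansion on `|x - c| ≤ δ`; relative to the main term `≍ λ₂^{-1/2}` this is only a saving
`(λ₂³/λ₃²)^{-1/10}`.  The sharper classical form (Graham–Kolesnik, Lemma 3.4 type; Huxley, *Area, lattice
points and exponential sums*, Lemma 5.1.3 type) replaces it by `O(λ₃/λ₂²)` up to a logarithm, which is what the
two-dimensional van der Corput method needs.  We prove, for `P` real with three derivatives on `[α, β]`,
`r ≤ P'' ≤ A r` (`r > 0`, `A ≥ 1`), `|P'''| ≤ λ₃`, `P'(c) = 0`, `α < c < β`:

  `‖∫_α^β e^{iP(x)} dx - 𝔣 e^{iP(c)} P''(c)^{-1/2}‖`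
  `   ≤ 2/(r(c-α)) + 2/(r(β-c)) + 2A³ (λ₃/r²) (2 + log(1 + (c-α)√r) + log(1 + (β-c)√r))`

(`stationaryPhase_log`; the concave case `stationaryPhase_log_neg` with `conj 𝔣`), assembled from
the one-sided statement `LogStatPhaseHyp.norm_integral_sub_main_le` on `[c, β]` (main term `fresnelLim = 𝔣/2`).
The tree's `StationaryPhaseSharp.lean` (`GK34.GrahamKolesnik_lemma34`) proves Graham–Kolesnik's Lemma 3.4 with the
log-free error `(b-a)(λ₄/λ₂² + λ₃²/λ₂³)` under a FOURTH derivative; the present version needs only three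
derivatives, at the cost of the factor `log(1 + (β-α)λ₂^{1/2})`, which is what the weighted `B`-process of
`WeightedStationaryPhase.lean` / `WeightedBProcess.lean` consumes.

## The argument (one-sided, on `[c, β]`)

Put `L = P''(c)`, `S(x) = (2L(P(x) - P(c)))^{1/2}`, `τ = S/L`, so that `P(c) + Lτ(x)²/2 = P(x)`
EXACTLY: the substitution `u = τ(x)` (forward form, Mathlib's `integral_comp_smul_deriv''`, no inverse
function) gives `∫_c^β e^{iP} τ' dx = e^{iP(c)} ∫_0^{τ(β)} e^{iLu²/2} du = e^{iP(c)}(fresnelLim L^{-1/2} + O(1/(r(β-c))))`.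
The defect `D = 1 - τ' = 1 - P'/S` satisfies, with NO smallness hypothesis,
`|D(x)| ≤ (A/3)(λ₃/r)(x - c)` (from `|P'² - S²| ≤ (2/3) A r λ₃ (x-c)³`, one mean value applied to
`P'² - 2L(P - P(c)) ∓ (2/3)Arλ₃(x-c)³`) and, for `q = D/P' = 1/P' - 1/S`, `|q| ≤ (A/3) λ₃/r²`,
`|q'| ≤ 2A³ λ₃/(r²(x-c))`; so `∫_c^β D e^{iP}` is `O(Aλ₃/r²)` on `[c, c + r^{-1/2}]` trivially and
`O(A³ (λ₃/r²) log((β-c)√r))` beyond by one integration by parts.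

## References

* E. C. Titchmarsh, *The Theory of the Riemann Zeta-Function*, 2nd ed. (1986), Lemma 4.6. [Titchmarsh1986]
* S. W. Graham, G. Kolesnik, *Van der Corput's Method of Exponential Sums*, LMS LN 126 (1991), Lemma 3.4.
  [GrahamKolesnik1991]
* M. N. Huxley, *Area, Lattice Points and Exponential Sums*, OUP 1996, §5.1. [Huxley1996]
-/

noncomputable section

open MeasureTheory Set intervalIntegral Complex Filter Topology

namespace Literature.Analysis.Fourier

/-! ### The one-sided quadratic model -/

/-- Scaling: `∫_0^T e^{iLu²/2} du = L^{-1/2} ∫_0^{T L^{1/2}} e^{iv²/2} dv` (`L > 0`). [folklore] -/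
theorem integral_quadratic_phase_right_eq {L : ℝ} (hL : 0 < L) (T : ℝ) :
    ∫ u in (0 : ℝ)..T, Complex.exp (I * ((L * u ^ 2 / 2 : ℝ) : ℂ))
      = ((Real.sqrt L)⁻¹ : ℝ) * fresnelS (T * Real.sqrt L) := by
  have hs : 0 < Real.sqrt L := Real.sqrt_pos.2 hL
  have hsq : Real.sqrt L ^ 2 = L := Real.sq_sqrt hL.le
  have h1 : ∫ u in (0 : ℝ)..T, Complex.exp (I * ((L * u ^ 2 / 2 : ℝ) : ℂ))
      = ∫ u in (0 : ℝ)..T, fresnelIntegrand (Real.sqrt L * u) := by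
    refine intervalIntegral.integral_congr fun u _ => ?_
    simp only [fresnelIntegrand]
    congr 3
    rw [mul_pow, hsq]
  rw [h1, intervalIntegral.integral_comp_mul_left fresnelIntegrand hs.ne', mul_zero, Complex.real_smul,
    mul_comm (Real.sqrt L) T]
  rfl

/-- **The one-sided quadratic model**: `‖∫_0^T e^{iLu²/2} du - fresnelLim · L^{-1/2}‖ ≤ 2/(TL)`
(`L, T > 0`). [cite: Titchmarsh1986, proof of Lemma 4.6] -/
theorem norm_integral_quadratic_phase_right_sub_le {L T : ℝ} (hL : 0 < L) (hT : 0 < T) :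
    ‖(∫ u in (0 : ℝ)..T, Complex.exp (I * ((L * u ^ 2 / 2 : ℝ) : ℂ)))
        - fresnelLim * ((Real.sqrt L)⁻¹ : ℝ)‖ ≤ 2 / (T * L) := by
  have hs : 0 < Real.sqrt L := Real.sqrt_pos.2 hL
  rw [integral_quadratic_phase_right_eq hL, mul_comm fresnelLim, ← mul_sub, norm_mul, Complex.norm_real,
    Real.norm_eq_abs, abs_of_pos (inv_pos.2 hs)]
  have h := norm_fresnelS_sub_fresnelLim_le (X := T * Real.sqrt L) (by positivity)
  calc (Real.sqrt L)⁻¹ * ‖fresnelS (T * Real.sqrt L) - fresnelLim‖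
      ≤ (Real.sqrt L)⁻¹ * (2 / (T * Real.sqrt L)) := by gcongr
    _ = 2 / (T * (Real.sqrt L * Real.sqrt L)) := by field_simp
    _ = 2 / (T * L) := by rw [Real.mul_self_sqrt hL.le]

/-! ### One mean value -/

/-- If `f(c) = 0` and `f' ≤ 0` on `(c, x)` (`f` differentiable on `[c, x]`) then `f(x) ≤ 0`. [folklore] -/
theorem apply_nonpos_of_deriv_nonpos {f f' : ℝ → ℝ} {c x : ℝ} (hcx : c ≤ x)
    (hf : ∀ y ∈ Icc c x, HasDerivAt f (f' y) y) (hf' : ∀ y ∈ Ioo c x, f' y ≤ 0) (h0 : f c = 0) :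
    f x ≤ 0 := by
  rcases eq_or_lt_of_le hcx with h | h
  · subst h; rw [h0]
  obtain ⟨ξ, hξ, hξ'⟩ := exists_hasDerivAt_eq_sub h hf
  rw [h0, sub_zero] at hξ'
  rw [hξ']
  exact mul_nonpos_of_nonpos_of_nonneg (hf' ξ hξ) (by linarith)

/-- If `f(c) = 0` and `f' ≥ 0` on `(c, x)` then `f(x) ≥ 0`. [folklore] -/
theorem apply_nonneg_of_deriv_nonneg {f f' : ℝ → ℝ} {c x : ℝ} (hcx : c ≤ x)
    (hf : ∀ y ∈ Icc c x, HasDerivAt f (f' y) y) (hf' : ∀ y ∈ Ioo c x, 0 ≤ f' y) (h0 : f c = 0) :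
    0 ≤ f x := by
  rcases eq_or_lt_of_le hcx with h | h
  · subst h; rw [h0]
  obtain ⟨ξ, hξ, hξ'⟩ := exists_hasDerivAt_eq_sub h hf
  rw [h0, sub_zero] at hξ'
  rw [hξ']
  exact mul_nonneg (hf' ξ hξ) (by linarith)

/-! ### The key algebraic inequality -/

/-- The pointwise algebra behind `|q'| ≤ 2A³λ₃/(r²u)`: with `u = x - c`, `p₁ = P'(x) ∈ [ru, Aru]`,
`s = S(x) ∈ [ru, Aru]`, `L = P''(c) ∈ [r, Ar]`, `|P''(x) - L| ≤ λ₃u`, `|p₁² - s²| ≤ (2/3)Arλ₃u³`: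
`|-P''/p₁² + (Lp₁/s)/s²| ≤ 2A³λ₃/(r²u)`, because
`Lp₁³ - P'' s³ = s²(L(p₁ - s) - (P'' - L)s) + Lp₁(p₁² - s²)` and `p₁ - s = (p₁² - s²)/(p₁ + s)`. [folklore] -/
theorem qderiv_algebra {u r A lam3 p1 p2 s L : ℝ} (hu : 0 < u) (hr : 0 < r) (hA : 1 ≤ A) (hl : 0 ≤ lam3)
    (hPlo : r * u ≤ p1) (hPhi : p1 ≤ A * r * u) (hSlo : r * u ≤ s) (hShi : s ≤ A * r * u)
    (hLlo : r ≤ L) (hLhi : L ≤ A * r)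
    (h3 : |p2 - L| ≤ lam3 * u) (hN : |p1 ^ 2 - s ^ 2| ≤ 2 / 3 * A * r * lam3 * u ^ 3) :
    |-p2 / p1 ^ 2 + (L * p1 / s) / s ^ 2| ≤ 2 * A ^ 3 * lam3 / (r ^ 2 * u) := by
  have hA0 : 0 < A := by linarith
  have hru : 0 < r * u := mul_pos hr hu
  have hP : 0 < p1 := hru.trans_le hPlo
  have hS : 0 < s := hru.trans_le hSlo
  have hL : 0 < L := hr.trans_le hLlo
  have hps : 0 < p1 + s := by positivity
  -- `q' = (L p1³ - p2 s³)/(p1² s³)`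
  have hden0 : 0 < p1 ^ 2 * s ^ 3 := by positivity
  have heq : -p2 / p1 ^ 2 + (L * p1 / s) / s ^ 2 = (L * p1 ^ 3 - p2 * s ^ 3) / (p1 ^ 2 * s ^ 3) := by
    field_simp
    ring
  rw [heq, abs_div, abs_of_pos hden0]
  -- decomposition of the numerator
  have hsub : p1 - s = (p1 ^ 2 - s ^ 2) / (p1 + s) := by
    field_simp
    ring
  have hnum : L * p1 ^ 3 - p2 * s ^ 3
      = s ^ 2 * (L * ((p1 ^ 2 - s ^ 2) / (p1 + s)) - (p2 - L) * s) + L * p1 * (p1 ^ 2 - s ^ 2) := by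
    rw [← hsub]
    ring
  -- bounds on the pieces
  have hb1 : |L * ((p1 ^ 2 - s ^ 2) / (p1 + s))| ≤ 1 / 3 * A ^ 2 * r * lam3 * u ^ 2 := by
    rw [abs_mul, abs_of_pos hL, abs_div, abs_of_pos hps]
    have hden : r * u + r * u ≤ p1 + s := add_le_add hPlo hSlo
    have h2ru : 0 < r * u + r * u := by positivity
    calc L * (|p1 ^ 2 - s ^ 2| / (p1 + s)) ≤ (A * r) * ((2 / 3 * A * r * lam3 * u ^ 3) / (r * u + r * u)) :=
          mul_le_mul hLhi (div_le_div₀ (by positivity) hN h2ru hden) (by positivity) (by positivity)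
      _ = 1 / 3 * A ^ 2 * r * lam3 * u ^ 2 := by
          field_simp
          ring
  have hb2 : |(p2 - L) * s| ≤ A * r * lam3 * u ^ 2 := by
    rw [abs_mul, abs_of_pos hS]
    calc |p2 - L| * s ≤ (lam3 * u) * (A * r * u) := mul_le_mul h3 hShi hS.le (by positivity)
      _ = A * r * lam3 * u ^ 2 := by ring
  have hb12 : |L * ((p1 ^ 2 - s ^ 2) / (p1 + s)) - (p2 - L) * s| ≤ 4 / 3 * A ^ 2 * r * lam3 * u ^ 2 := by
    have h0 := abs_sub (L * ((p1 ^ 2 - s ^ 2) / (p1 + s))) ((p2 - L) * s)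
    have hA2 : A * r * lam3 * u ^ 2 ≤ A ^ 2 * r * lam3 * u ^ 2 := by
      have hAA : A ≤ A ^ 2 := by nlinarith
      have : 0 ≤ r * lam3 * u ^ 2 := by positivity
      nlinarith
    linarith
  have hb3 : |L * p1 * (p1 ^ 2 - s ^ 2)| ≤ 2 / 3 * A ^ 3 * r ^ 3 * lam3 * u ^ 4 := by
    rw [abs_mul, abs_mul, abs_of_pos hL, abs_of_pos hP]
    calc L * p1 * |p1 ^ 2 - s ^ 2| ≤ (A * r) * (A * r * u) * (2 / 3 * A * r * lam3 * u ^ 3) := by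
          refine mul_le_mul (mul_le_mul hLhi hPhi hP.le (by positivity)) hN (abs_nonneg _) (by positivity)
      _ = 2 / 3 * A ^ 3 * r ^ 3 * lam3 * u ^ 4 := by ring
  have hnumb : |L * p1 ^ 3 - p2 * s ^ 3|
      ≤ s ^ 2 * (4 / 3 * A ^ 2 * r * lam3 * u ^ 2) + 2 / 3 * A ^ 3 * r ^ 3 * lam3 * u ^ 4 := by
    rw [hnum]
    refine (abs_add_le _ _).trans (add_le_add ?_ hb3)
    rw [abs_mul, abs_of_nonneg (sq_nonneg s)]
    exact mul_le_mul_of_nonneg_left hb12 (sq_nonneg s)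
  -- divide
  have h1 : (r * u) ^ 2 ≤ p1 ^ 2 := pow_le_pow_left₀ hru.le hPlo 2
  have h2 : (r * u) ^ 3 ≤ s ^ 3 := pow_le_pow_left₀ hru.le hSlo 3
  have hfrac1 : s ^ 2 * (4 / 3 * A ^ 2 * r * lam3 * u ^ 2) / (p1 ^ 2 * s ^ 3)
      ≤ 4 / 3 * A ^ 2 * lam3 / (r ^ 2 * u) := by
    rw [div_le_div_iff₀ hden0 (by positivity)]
    calc s ^ 2 * (4 / 3 * A ^ 2 * r * lam3 * u ^ 2) * (r ^ 2 * u)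
        = 4 / 3 * A ^ 2 * lam3 * ((r * u) ^ 2 * (s ^ 2 * (r * u))) := by ring
      _ ≤ 4 / 3 * A ^ 2 * lam3 * (p1 ^ 2 * (s ^ 2 * s)) := by gcongr
      _ = 4 / 3 * A ^ 2 * lam3 * (p1 ^ 2 * s ^ 3) := by ring
  have hfrac2 : 2 / 3 * A ^ 3 * r ^ 3 * lam3 * u ^ 4 / (p1 ^ 2 * s ^ 3) ≤ 2 / 3 * A ^ 3 * lam3 / (r ^ 2 * u) := by
    rw [div_le_div_iff₀ hden0 (by positivity)]
    calc 2 / 3 * A ^ 3 * r ^ 3 * lam3 * u ^ 4 * (r ^ 2 * u)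
        = 2 / 3 * A ^ 3 * lam3 * ((r * u) ^ 2 * (r * u) ^ 3) := by ring
      _ ≤ 2 / 3 * A ^ 3 * lam3 * (p1 ^ 2 * s ^ 3) := by gcongr
  have hA23 : 4 / 3 * A ^ 2 * lam3 / (r ^ 2 * u) ≤ 4 / 3 * A ^ 3 * lam3 / (r ^ 2 * u) := by
    have hAA : A ^ 2 ≤ A ^ 3 := by nlinarith
    gcongr
  calc |L * p1 ^ 3 - p2 * s ^ 3| / (p1 ^ 2 * s ^ 3)
      ≤ (s ^ 2 * (4 / 3 * A ^ 2 * r * lam3 * u ^ 2) + 2 / 3 * A ^ 3 * r ^ 3 * lam3 * u ^ 4) / (p1 ^ 2 * s ^ 3) :=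
        div_le_div_of_nonneg_right hnumb hden0.le
    _ = s ^ 2 * (4 / 3 * A ^ 2 * r * lam3 * u ^ 2) / (p1 ^ 2 * s ^ 3)
          + 2 / 3 * A ^ 3 * r ^ 3 * lam3 * u ^ 4 / (p1 ^ 2 * s ^ 3) := by rw [add_div]
    _ ≤ 4 / 3 * A ^ 3 * lam3 / (r ^ 2 * u) + 2 / 3 * A ^ 3 * lam3 / (r ^ 2 * u) := by linarith
    _ = 2 * A ^ 3 * lam3 / (r ^ 2 * u) := by ring

/-! ### The hypotheses on `[c, β]` and the elementary estimates -/

/-- Hypotheses of the one-sided sharp stationary-phase lemma on `[c, β]`: three derivatives,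
`r ≤ P'' ≤ Ar`, `|P'''| ≤ λ₃`, `P'(c) = 0`, `c < β`, `r > 0`, `A ≥ 1`. [folklore] -/
structure LogStatPhaseHyp (P P' P'' P''' : ℝ → ℝ) (c β r A lam3 : ℝ) : Prop where
  hcβ : c < β
  hr : 0 < r
  hA : 1 ≤ A
  hP : ∀ x ∈ Icc c β, HasDerivAt P (P' x) x
  hP' : ∀ x ∈ Icc c β, HasDerivAt P' (P'' x) x
  hP'' : ∀ x ∈ Icc c β, HasDerivAt P'' (P''' x) x
  h2 : ∀ x ∈ Icc c β, r ≤ P'' x ∧ P'' x ≤ A * r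
  h3 : ∀ x ∈ Icc c β, |P''' x| ≤ lam3
  hc : P' c = 0

namespace LogStatPhaseHyp

variable {P P' P'' P''' : ℝ → ℝ} {c β r A lam3 : ℝ} (H : LogStatPhaseHyp P P' P'' P''' c β r A lam3)
include H

/-- `c ∈ [c, β]`. [folklore] -/
theorem cmem : c ∈ Icc c β := ⟨le_rfl, H.hcβ.le⟩

/-- `λ₃ ≥ 0`. [folklore] -/
theorem lam3_nonneg : 0 ≤ lam3 := (abs_nonneg _).trans (H.h3 c H.cmem)

/-- `L = P''(c) ∈ [r, Ar]`. [folklore] -/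
theorem L_bounds : r ≤ P'' c ∧ P'' c ≤ A * r := H.h2 c H.cmem

/-- `L = P''(c) > 0`. [folklore] -/
theorem L_pos : 0 < P'' c := H.hr.trans_le H.L_bounds.1

/-- (F1) `r(x-c) ≤ P'(x) ≤ Ar(x-c)`. [folklore] -/
theorem deriv_bounds {x : ℝ} (hx : x ∈ Icc c β) : r * (x - c) ≤ P' x ∧ P' x ≤ A * r * (x - c) :=
  deriv_bounds_right H.hP' H.h2 H.cmem H.hc hx hx.1

/-- (F2) `r(x-c)²/2 ≤ P(x) - P(c) ≤ Ar(x-c)²/2`. [folklore] -/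
theorem value_bounds {x : ℝ} (hx : x ∈ Icc c β) :
    r * (x - c) ^ 2 / 2 ≤ P x - P c ∧ P x - P c ≤ A * r * (x - c) ^ 2 / 2 := by
  have hsub : Icc c x ⊆ Icc c β := Icc_subset_Icc le_rfl hx.2
  constructor
  · -- `f(y) = r(y-c)²/2 - (P y - P c)`, `f' = r(y-c) - P' y ≤ 0`
    have hd : ∀ y ∈ Icc c x, HasDerivAt (fun y => r * (y - c) ^ 2 / 2 - (P y - P c))
        (r * (y - c) - P' y) y := fun y hy =>
      (hasDerivAt_const_mul_sub_sq r c y).sub ((H.hP y (hsub hy)).sub_const (P c))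
    have h : r * (x - c) ^ 2 / 2 - (P x - P c) ≤ 0 :=
      apply_nonpos_of_deriv_nonpos (f := fun y => r * (y - c) ^ 2 / 2 - (P y - P c)) hx.1 hd
        (fun y hy => by have := (H.deriv_bounds (hsub (Ioo_subset_Icc_self hy))).1; linarith) (by simp)
    linarith
  · have hd : ∀ y ∈ Icc c x, HasDerivAt (fun y => (P y - P c) - A * r * (y - c) ^ 2 / 2)
        (P' y - A * r * (y - c)) y := fun y hy =>
      ((H.hP y (hsub hy)).sub_const (P c)).sub (hasDerivAt_const_mul_sub_sq (A * r) c y)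
    have h : (P x - P c) - A * r * (x - c) ^ 2 / 2 ≤ 0 :=
      apply_nonpos_of_deriv_nonpos (f := fun y => (P y - P c) - A * r * (y - c) ^ 2 / 2) hx.1 hd
        (fun y hy => by have := (H.deriv_bounds (hsub (Ioo_subset_Icc_self hy))).2; linarith) (by simp)
    linarith

/-- `P(x) ≥ P(c)`. [folklore] -/
theorem value_nonneg {x : ℝ} (hx : x ∈ Icc c β) : 0 ≤ P x - P c := by
  have := (H.value_bounds hx).1
  have : 0 ≤ r * (x - c) ^ 2 / 2 := by have := H.hr; positivity
  linarith

/-- (F3) `|P''(x) - P''(c)| ≤ λ₃ (x - c)`. [folklore] -/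
theorem abs_second_sub_le {x : ℝ} (hx : x ∈ Icc c β) : |P'' x - P'' c| ≤ lam3 * (x - c) := by
  rcases eq_or_lt_of_le hx.1 with h | h
  · subst h; simp
  have hsub : Icc c x ⊆ Icc c β := Icc_subset_Icc le_rfl hx.2
  obtain ⟨ξ, hξ, hξ'⟩ := exists_hasDerivAt_eq_sub h (fun y hy => H.hP'' y (hsub hy))
  rw [hξ', abs_mul, abs_of_pos (sub_pos.2 h)]
  exact mul_le_mul_of_nonneg_right (H.h3 ξ (hsub (Ioo_subset_Icc_self hξ))) (by linarith)

/-- (F4) `|P'(x)² - 2L(P(x) - P(c))| ≤ (2/3) A r λ₃ (x - c)³`, `L = P''(c)`. [folklore] -/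
theorem abs_N_le {x : ℝ} (hx : x ∈ Icc c β) :
    |P' x ^ 2 - 2 * P'' c * (P x - P c)| ≤ 2 / 3 * A * r * lam3 * (x - c) ^ 3 := by
  have hsub : Icc c x ⊆ Icc c β := Icc_subset_Icc le_rfl hx.2
  -- the derivative of `N(y) = P'(y)² - 2L(P y - P c)` is `2P'(y)(P''(y) - L)`
  have hN : ∀ y ∈ Icc c x, HasDerivAt (fun y => P' y ^ 2 - 2 * P'' c * (P y - P c))
      (2 * P' y * (P'' y - P'' c)) y := by
    intro y hy
    have h1 : HasDerivAt (fun y => P' y ^ 2) (2 * P' y * P'' y) y :=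
      ((H.hP' y (hsub hy)).fun_pow 2).congr_deriv (by norm_num)
    have h2 : HasDerivAt (fun y => 2 * P'' c * (P y - P c)) (2 * P'' c * P' y) y :=
      ((H.hP y (hsub hy)).sub_const (P c)).const_mul (2 * P'' c)
    exact (h1.sub h2).congr_deriv (by ring)
  have hcube : ∀ y : ℝ, HasDerivAt (fun y => 2 / 3 * A * r * lam3 * (y - c) ^ 3)
      (2 * A * r * lam3 * (y - c) ^ 2) y := by
    intro y
    have := (((hasDerivAt_id' y).sub_const c).fun_pow 3).const_mul (2 / 3 * A * r * lam3)
    exact this.congr_deriv (by norm_num; ring)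
  -- the key pointwise inequality `|2P'(P'' - L)| ≤ 2Arλ₃(y-c)²`
  have hkey : ∀ y ∈ Ioo c x, |2 * P' y * (P'' y - P'' c)| ≤ 2 * A * r * lam3 * (y - c) ^ 2 := by
    intro y hy
    have hyI : y ∈ Icc c β := hsub (Ioo_subset_Icc_self hy)
    have hd := H.deriv_bounds hyI
    have h0 : 0 ≤ P' y := le_trans (mul_nonneg H.hr.le (by linarith [hy.1])) hd.1
    have h3 := H.abs_second_sub_le hyI
    rw [abs_mul, abs_mul, abs_of_pos (by norm_num : (0 : ℝ) < 2), abs_of_nonneg h0]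
    have hyc : 0 ≤ y - c := by linarith [hy.1]
    have hA := (lt_of_lt_of_le one_pos H.hA); have hr := H.hr
    calc 2 * P' y * |P'' y - P'' c| ≤ 2 * (A * r * (y - c)) * (lam3 * (y - c)) :=
          mul_le_mul (by linarith [hd.2]) h3 (abs_nonneg _) (by positivity)
      _ = 2 * A * r * lam3 * (y - c) ^ 2 := by ring
  rw [abs_le]
  constructor
  · -- lower bound: `g = N + (2/3)Arλ₃(y-c)³` is nondecreasing
    have hd : ∀ y ∈ Icc c x, HasDerivAt
        (fun y => P' y ^ 2 - 2 * P'' c * (P y - P c) + 2 / 3 * A * r * lam3 * (y - c) ^ 3)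
        (2 * P' y * (P'' y - P'' c) + 2 * A * r * lam3 * (y - c) ^ 2) y :=
      fun y hy => (hN y hy).add (hcube y)
    have h : 0 ≤ P' x ^ 2 - 2 * P'' c * (P x - P c) + 2 / 3 * A * r * lam3 * (x - c) ^ 3 :=
      apply_nonneg_of_deriv_nonneg
        (f := fun y => P' y ^ 2 - 2 * P'' c * (P y - P c) + 2 / 3 * A * r * lam3 * (y - c) ^ 3) hx.1 hd
        (fun y hy => by
          have := neg_abs_le (2 * P' y * (P'' y - P'' c)); have := hkey y hy; linarith) (by simp [H.hc])
    linarith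
  · have hd : ∀ y ∈ Icc c x, HasDerivAt
        (fun y => P' y ^ 2 - 2 * P'' c * (P y - P c) - 2 / 3 * A * r * lam3 * (y - c) ^ 3)
        (2 * P' y * (P'' y - P'' c) - 2 * A * r * lam3 * (y - c) ^ 2) y :=
      fun y hy => (hN y hy).sub (hcube y)
    have h : P' x ^ 2 - 2 * P'' c * (P x - P c) - 2 / 3 * A * r * lam3 * (x - c) ^ 3 ≤ 0 :=
      apply_nonpos_of_deriv_nonpos
        (f := fun y => P' y ^ 2 - 2 * P'' c * (P y - P c) - 2 / 3 * A * r * lam3 * (y - c) ^ 3) hx.1 hd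
        (fun y hy => by
          have := le_abs_self (2 * P' y * (P'' y - P'' c)); have := hkey y hy; linarith) (by simp [H.hc])
    linarith

/-! ### The functions `S = (2L(P - P(c)))^{1/2}` and `q = 1/P' - 1/S` -/

/-- `S(x) = (2 P''(c) (P(x) - P(c)))^{1/2}`. [folklore] -/
def S (_H : LogStatPhaseHyp P P' P'' P''' c β r A lam3) (x : ℝ) : ℝ := Real.sqrt (2 * P'' c * (P x - P c))

/-- Unfolding `S`. [folklore] -/
theorem S_def (x : ℝ) : H.S x = Real.sqrt (2 * P'' c * (P x - P c)) := rfl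

/-- The radicand of `S` is nonnegative. [folklore] -/
theorem inner_nonneg {x : ℝ} (hx : x ∈ Icc c β) : 0 ≤ 2 * P'' c * (P x - P c) :=
  mul_nonneg (mul_nonneg (by norm_num) H.L_pos.le) (H.value_nonneg hx)

/-- `S ≥ 0`. [folklore] -/
theorem S_nonneg (x : ℝ) : 0 ≤ H.S x := Real.sqrt_nonneg _

/-- `S² = 2L(P - P(c))`. [folklore] -/
theorem S_sq {x : ℝ} (hx : x ∈ Icc c β) : H.S x ^ 2 = 2 * P'' c * (P x - P c) := by
  rw [S_def, Real.sq_sqrt (H.inner_nonneg hx)]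

/-- `S(c) = 0`. [folklore] -/
theorem S_c : H.S c = 0 := by simp [S_def]

/-- (F5) `r(x-c) ≤ S(x) ≤ Ar(x-c)`. [folklore] -/
theorem S_bounds {x : ℝ} (hx : x ∈ Icc c β) : r * (x - c) ≤ H.S x ∧ H.S x ≤ A * r * (x - c) := by
  have hxc : 0 ≤ x - c := by linarith [hx.1]
  have hv := H.value_bounds hx
  have hL := H.L_bounds
  have hr := H.hr
  have hA := (lt_of_lt_of_le one_pos H.hA)
  constructor
  · have h1 : (r * (x - c)) ^ 2 ≤ 2 * P'' c * (P x - P c) := by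
      calc (r * (x - c)) ^ 2 = 2 * r * (r * (x - c) ^ 2 / 2) := by ring
        _ ≤ 2 * P'' c * (P x - P c) :=
            mul_le_mul (by linarith [hL.1]) hv.1 (by positivity) (by linarith [H.L_pos])
    calc r * (x - c) = Real.sqrt ((r * (x - c)) ^ 2) := (Real.sqrt_sq (by positivity)).symm
      _ ≤ H.S x := Real.sqrt_le_sqrt h1
  · have h1 : 2 * P'' c * (P x - P c) ≤ (A * r * (x - c)) ^ 2 := by
      calc 2 * P'' c * (P x - P c) ≤ 2 * (A * r) * (A * r * (x - c) ^ 2 / 2) :=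
            mul_le_mul (by linarith [hL.2]) hv.2 (H.value_nonneg hx) (by positivity)
        _ = (A * r * (x - c)) ^ 2 := by ring
    calc H.S x ≤ Real.sqrt ((A * r * (x - c)) ^ 2) := Real.sqrt_le_sqrt h1
      _ = A * r * (x - c) := Real.sqrt_sq (by positivity)

/-- `S > 0` on `(c, β]`. [folklore] -/
theorem S_pos {x : ℝ} (hx : x ∈ Ioc c β) : 0 < H.S x :=
  lt_of_lt_of_le (mul_pos H.hr (sub_pos.2 hx.1)) (H.S_bounds (Ioc_subset_Icc_self hx)).1

/-- `P' > 0` on `(c, β]`. [folklore] -/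
theorem deriv_pos {x : ℝ} (hx : x ∈ Ioc c β) : 0 < P' x :=
  lt_of_lt_of_le (mul_pos H.hr (sub_pos.2 hx.1)) (H.deriv_bounds (Ioc_subset_Icc_self hx)).1

/-- (F6) `|P'(x)/S(x) - 1| ≤ (A/3)(λ₃/r)(x - c)` on `(c, β]`. [folklore] -/
theorem abs_ratio_sub_one_le {x : ℝ} (hx : x ∈ Ioc c β) :
    |P' x / H.S x - 1| ≤ A / 3 * (lam3 / r) * (x - c) := by
  have hxI : x ∈ Icc c β := Ioc_subset_Icc_self hx
  have hu : 0 < x - c := sub_pos.2 hx.1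
  have hS := H.S_pos hx
  have hP := H.deriv_pos hx
  have hSb := (H.S_bounds hxI).1
  have hPb := (H.deriv_bounds hxI).1
  have hN := H.abs_N_le hxI
  have hr := H.hr
  rw [← H.S_sq hxI] at hN
  -- `P'/S - 1 = (P'² - S²)/(S(P'+S))`
  have heq : P' x / H.S x - 1 = (P' x ^ 2 - H.S x ^ 2) / (H.S x * (P' x + H.S x)) := by
    field_simp; ring
  have hdenpos : 0 < H.S x * (P' x + H.S x) := mul_pos hS (add_pos hP hS)
  rw [heq, abs_div, abs_of_pos hdenpos]
  have hden : r * (x - c) * (r * (x - c) + r * (x - c)) ≤ H.S x * (P' x + H.S x) :=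
    mul_le_mul hSb (add_le_add hPb hSb) (by positivity) (H.S_nonneg x)
  have hden0 : 0 < r * (x - c) * (r * (x - c) + r * (x - c)) := by positivity
  calc |P' x ^ 2 - H.S x ^ 2| / (H.S x * (P' x + H.S x))
      ≤ (2 / 3 * A * r * lam3 * (x - c) ^ 3) / (r * (x - c) * (r * (x - c) + r * (x - c))) :=
        div_le_div₀ (by have := (lt_of_lt_of_le one_pos H.hA); have := H.lam3_nonneg; positivity) hN hden0 hden
    _ = A / 3 * (lam3 / r) * (x - c) := by field_simp; ring

/-- `q = 1/P' - 1/S`. [folklore] -/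
def q (_H : LogStatPhaseHyp P P' P'' P''' c β r A lam3) (x : ℝ) : ℝ :=
  (P' x)⁻¹ - (Real.sqrt (2 * P'' c * (P x - P c)))⁻¹

/-- Unfolding `q`. [folklore] -/
theorem q_def (x : ℝ) : H.q x = (P' x)⁻¹ - (H.S x)⁻¹ := rfl

/-- (F8) `|q(x)| ≤ (A/3) λ₃/r²` on `(c, β]`. [folklore] -/
theorem abs_q_le {x : ℝ} (hx : x ∈ Ioc c β) : |H.q x| ≤ A / 3 * (lam3 / r ^ 2) := by
  have hxI : x ∈ Icc c β := Ioc_subset_Icc_self hx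
  have hu : 0 < x - c := sub_pos.2 hx.1
  have hS := H.S_pos hx
  have hP := H.deriv_pos hx
  have hSb := (H.S_bounds hxI).1
  have hPb := (H.deriv_bounds hxI).1
  have hN := H.abs_N_le hxI
  have hr := H.hr
  rw [← H.S_sq hxI] at hN
  have heq : H.q x = -(P' x ^ 2 - H.S x ^ 2) / ((P' x + H.S x) * P' x * H.S x) := by
    rw [q_def]; field_simp; ring
  have hdenpos : 0 < (P' x + H.S x) * P' x * H.S x := mul_pos (mul_pos (add_pos hP hS) hP) hS
  rw [heq, abs_div, abs_neg, abs_of_pos hdenpos]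
  have hden : (r * (x - c) + r * (x - c)) * (r * (x - c)) * (r * (x - c))
      ≤ (P' x + H.S x) * P' x * H.S x := by
    have h0 : 0 ≤ r * (x - c) := mul_nonneg hr.le hu.le
    gcongr
  have hden0 : 0 < (r * (x - c) + r * (x - c)) * (r * (x - c)) * (r * (x - c)) := by positivity
  calc |P' x ^ 2 - H.S x ^ 2| / ((P' x + H.S x) * P' x * H.S x)
      ≤ (2 / 3 * A * r * lam3 * (x - c) ^ 3) / ((r * (x - c) + r * (x - c)) * (r * (x - c)) * (r * (x - c))) :=
        div_le_div₀ (by have := (lt_of_lt_of_le one_pos H.hA); have := H.lam3_nonneg; positivity) hN hden0 hden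
    _ = A / 3 * (lam3 / r ^ 2) := by field_simp; ring

/-- The derivative of `S` on `(c, β)`: `S' = L P'/S`. [folklore] -/
theorem hasDerivAt_S {x : ℝ} (hx : x ∈ Ioc c β) : HasDerivAt H.S (P'' c * P' x / H.S x) x := by
  have hxI : x ∈ Icc c β := Ioc_subset_Icc_self hx
  have hS := H.S_pos hx
  have hin : HasDerivAt (fun y => 2 * P'' c * (P y - P c)) (2 * P'' c * P' x) x :=
    ((H.hP x hxI).sub_const (P c)).const_mul (2 * P'' c)
  have hne : 2 * P'' c * (P x - P c) ≠ 0 := by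
    intro h0
    have : H.S x = 0 := by rw [S_def, h0, Real.sqrt_zero]
    linarith
  have h := hin.sqrt hne
  have hfun : (fun y => Real.sqrt (2 * P'' c * (P y - P c))) = H.S := rfl
  rw [hfun] at h
  refine h.congr_deriv ?_
  rw [← H.S_def]
  field_simp

/-- The derivative of `q` on `(c, β)`: `q' = -P''/P'² + (L P'/S)/S²`. [folklore] -/
theorem hasDerivAt_q {x : ℝ} (hx : x ∈ Ioc c β) :
    HasDerivAt H.q (-(P'' x) / (P' x) ^ 2 + (P'' c * P' x / H.S x) / (H.S x) ^ 2) x := by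
  have hxI : x ∈ Icc c β := Ioc_subset_Icc_self hx
  have hS := H.S_pos hx
  have hP := H.deriv_pos hx
  have h1 := (H.hP' x hxI).inv hP.ne'
  have h2 := (H.hasDerivAt_S hx).inv hS.ne'
  have h := h1.sub h2
  have hfun : P'⁻¹ - (H.S)⁻¹ = H.q := by funext y; rfl
  rw [hfun] at h
  refine h.congr_deriv ?_
  ring

/-- (F7) **The key pointwise bound** `|q'(x)| ≤ 2A³ λ₃/(r²(x - c))` on `(c, β)`. [folklore] -/
theorem abs_qderiv_le {x : ℝ} (hx : x ∈ Ioc c β) :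
    |-(P'' x) / (P' x) ^ 2 + (P'' c * P' x / H.S x) / (H.S x) ^ 2| ≤ 2 * A ^ 3 * lam3 / (r ^ 2 * (x - c)) := by
  have hxI : x ∈ Icc c β := Ioc_subset_Icc_self hx
  have hN := H.abs_N_le hxI
  rw [← H.S_sq hxI] at hN
  exact qderiv_algebra (sub_pos.2 hx.1) H.hr H.hA H.lam3_nonneg (H.deriv_bounds hxI).1 (H.deriv_bounds hxI).2
    (H.S_bounds hxI).1 (H.S_bounds hxI).2 H.L_bounds.1 H.L_bounds.2 (H.abs_second_sub_le hxI) hN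


/-! ### Continuity, the extended ratio `P'/S`, and the substitution -/

/-- `P` is continuous on `[c, β]`. [folklore] -/
theorem continuousOn_P : ContinuousOn P (Icc c β) := fun x hx => (H.hP x hx).continuousAt.continuousWithinAt

/-- `P'` is continuous on `[c, β]`. [folklore] -/
theorem continuousOn_P' : ContinuousOn P' (Icc c β) := fun x hx => (H.hP' x hx).continuousAt.continuousWithinAt

/-- `P''` is continuous on `[c, β]`. [folklore] -/
theorem continuousOn_P'' : ContinuousOn P'' (Icc c β) :=
  fun x hx => (H.hP'' x hx).continuousAt.continuousWithinAt

/-- `S` is continuous on `[c, β]`. [folklore] -/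
theorem continuousOn_S : ContinuousOn H.S (Icc c β) := by
  have h : ContinuousOn (fun x => 2 * P'' c * (P x - P c)) (Icc c β) :=
    continuousOn_const.mul (H.continuousOn_P.sub continuousOn_const)
  exact Real.continuous_sqrt.comp_continuousOn h

/-- The extended ratio `τ' = P'/S`, set equal to `1` at (and to the left of) `c`. [folklore] -/
def ratio (_H : LogStatPhaseHyp P P' P'' P''' c β r A lam3) (x : ℝ) : ℝ :=
  if x ≤ c then 1 else P' x / Real.sqrt (2 * P'' c * (P x - P c))

/-- `τ' = P'/S` to the right of `c`. [folklore] -/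
theorem ratio_of_gt {x : ℝ} (hx : c < x) : H.ratio x = P' x / H.S x := by
  simp [ratio, not_le.2 hx, S_def]

/-- `τ'(c) = 1`. [folklore] -/
theorem ratio_c : H.ratio c = 1 := by simp [ratio]

/-- `|τ'(x) - 1| ≤ (A/3)(λ₃/r)(x - c)` on `[c, β]`. [folklore] -/
theorem abs_ratio_sub_one_le' {x : ℝ} (hx : x ∈ Icc c β) : |H.ratio x - 1| ≤ A / 3 * (lam3 / r) * (x - c) := by
  rcases eq_or_lt_of_le hx.1 with h | h
  · subst h; simp [H.ratio_c]
  · rw [H.ratio_of_gt h]; exact H.abs_ratio_sub_one_le ⟨h, hx.2⟩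

/-- `τ'` is continuous on `[c, β]`. [folklore] -/
theorem continuousOn_ratio : ContinuousOn H.ratio (Icc c β) := by
  intro x hx
  rcases eq_or_lt_of_le hx.1 with h | h
  · subst h
    rw [Metric.continuousWithinAt_iff]
    intro ε hε
    have hK0 : 0 ≤ A / 3 * (lam3 / r) := by
      have := (lt_of_lt_of_le one_pos H.hA); have := H.lam3_nonneg; have := H.hr; positivity
    refine ⟨ε / (A / 3 * (lam3 / r) + 1), by positivity, fun y hy hdist => ?_⟩
    rw [Real.dist_eq] at hdist ⊢
    rw [H.ratio_c]
    rw [abs_of_nonneg (by linarith [hy.1])] at hdist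
    have hb := H.abs_ratio_sub_one_le' hy
    calc |H.ratio y - 1| ≤ A / 3 * (lam3 / r) * (y - c) := hb
      _ ≤ A / 3 * (lam3 / r) * (ε / (A / 3 * (lam3 / r) + 1)) := by gcongr
      _ < ε := by
          rw [← mul_div_assoc, div_lt_iff₀ (by positivity)]
          nlinarith
  · have hS := H.S_pos ⟨h, hx.2⟩
    have hcont : ContinuousWithinAt (fun y => P' y / H.S y) (Icc c β) x :=
      (H.continuousOn_P' x hx).div (H.continuousOn_S x hx) hS.ne'
    refine hcont.congr_of_eventuallyEq ?_ (H.ratio_of_gt h)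
    filter_upwards [mem_nhdsWithin_of_mem_nhds (Ioi_mem_nhds h)] with y hy
    exact H.ratio_of_gt hy

/-- **The substitution** `u = τ(x) = S(x)/L`:
`∫_c^β τ'(x) e^{iP(x)} dx = e^{iP(c)} ∫_0^{S(β)/L} e^{iLu²/2} du` (`L = P''(c)`). [folklore] -/
theorem integral_ratio_mul_exp_eq :
    ∫ x in c..β, (H.ratio x : ℂ) * Complex.exp (I * P x)
      = Complex.exp (I * P c) * ∫ u in (0 : ℝ)..(H.S β / P'' c), Complex.exp (I * ((P'' c * u ^ 2 / 2 : ℝ) : ℂ)) := by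
  have hcβ := H.hcβ
  have hL := H.L_pos
  set τ : ℝ → ℝ := fun x => H.S x / P'' c with hτ
  set g : ℝ → ℂ := fun u => Complex.exp (I * ((P c + P'' c * u ^ 2 / 2 : ℝ) : ℂ)) with hg
  have hgc : Continuous g := by rw [hg]; fun_prop
  have hτc : ContinuousOn τ (uIcc c β) := by
    rw [uIcc_of_le hcβ.le]; exact H.continuousOn_S.div_const _
  have hτd : ∀ x ∈ Ioo (min c β) (max c β), HasDerivWithinAt τ (H.ratio x) (Ioi x) x := by
    intro x hx
    rw [min_eq_left hcβ.le, max_eq_right hcβ.le] at hx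
    have h := (H.hasDerivAt_S ⟨hx.1, hx.2.le⟩).div_const (P'' c)
    have hval : P'' c * P' x / H.S x / P'' c = H.ratio x := by
      rw [H.ratio_of_gt hx.1]; field_simp
    rw [hval] at h
    exact h.hasDerivWithinAt
  have hrc : ContinuousOn H.ratio (uIcc c β) := by rw [uIcc_of_le hcβ.le]; exact H.continuousOn_ratio
  have key := intervalIntegral.integral_deriv_smul_comp'' hτc hτd hrc hgc.continuousOn
  -- identify the two sides
  have hgτ : ∀ x ∈ Icc c β, (g ∘ τ) x = Complex.exp (I * P x) := by
    intro x hx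
    simp only [Function.comp_apply, hg, hτ]
    have : P c + P'' c * (H.S x / P'' c) ^ 2 / 2 = P x := by
      rw [div_pow, H.S_sq hx]; field_simp; ring
    rw [this]
  have hτ0 : τ c = 0 := by simp [hτ, H.S_c]
  have hL : (∫ x in c..β, H.ratio x • (g ∘ τ) x) = ∫ x in c..β, (H.ratio x : ℂ) * Complex.exp (I * P x) := by
    refine intervalIntegral.integral_congr fun x hx => ?_
    rw [uIcc_of_le hcβ.le] at hx
    simp only [Complex.real_smul, hgτ x hx]
  have hR : (∫ u in τ c..τ β, g u)
      = Complex.exp (I * P c) * ∫ u in (0 : ℝ)..(H.S β / P'' c), Complex.exp (I * ((P'' c * u ^ 2 / 2 : ℝ) : ℂ)) := by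
    rw [hτ0, ← intervalIntegral.integral_const_mul]
    refine intervalIntegral.integral_congr fun u _ => ?_
    simp only [hg]
    rw [← Complex.exp_add]
    congr 1
    push_cast
    ring
  rw [← hL, key, hR]

/-! ### The one-sided estimate -/

/-- **Sharp stationary phase, one-sided.**  Under `LogStatPhaseHyp` (three derivatives on `[c, β]`, `r ≤ P'' ≤ Ar`,
`|P'''| ≤ λ₃`, `P'(c) = 0`, `c < β`):
`‖∫_c^β e^{iP(x)} dx - e^{iP(c)} fresnelLim · P''(c)^{-1/2}‖ ≤ 2/(r(β-c)) + 2A³(λ₃/r²)(1 + log(1 + (β-c)√r))`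
(`fresnelLim = ∫_0^∞ e^{iu²/2} du = 𝔣/2`). [cite: GrahamKolesnik1991, Lemma 3.4] -/
theorem norm_integral_sub_main_le :
    ‖(∫ x in c..β, Complex.exp (I * P x)) - Complex.exp (I * P c) * fresnelLim * ((Real.sqrt (P'' c))⁻¹ : ℝ)‖
      ≤ 2 / (r * (β - c)) + 2 * A ^ 3 * (lam3 / r ^ 2) * (1 + Real.log (1 + (β - c) * Real.sqrt r)) := by
  have hcβ := H.hcβ
  have hr := H.hr
  have hA := (lt_of_lt_of_le one_pos H.hA)
  have hA1 := H.hA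
  have hl := H.lam3_nonneg
  have hL := H.L_pos
  have hβI : β ∈ Icc c β := right_mem_Icc.2 hcβ.le
  have hSβ : 0 < H.S β := H.S_pos ⟨hcβ, le_rfl⟩
  have hSβ' : r * (β - c) ≤ H.S β := (H.S_bounds hβI).1
  -- notation
  set E : ℝ → ℂ := fun x => Complex.exp (I * P x) with hE
  have hEc : ContinuousOn E (Icc c β) := continuousOn_exp_I_mul H.hP
  have hEn : ∀ x, ‖E x‖ = 1 := fun x => norm_exp_I_mul_ofReal (P x)
  have hRc : ContinuousOn (fun x => (H.ratio x : ℂ)) (Icc c β) :=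
    Complex.continuous_ofReal.comp_continuousOn H.continuousOn_ratio
  have hi1 : IntervalIntegrable (fun x => (H.ratio x : ℂ) * E x) volume c β :=
    ((hRc.mul hEc).mono (by rw [uIcc_of_le hcβ.le])).intervalIntegrable
  have hi2 : ∀ p ∈ Icc c β, ∀ q ∈ Icc c β, IntervalIntegrable (fun x => ((1 - H.ratio x : ℝ) : ℂ) * E x) volume p q := by
    intro p hp q hq
    refine (ContinuousOn.mul ?_ hEc).mono (uIcc_subset_Icc hp hq) |>.intervalIntegrable
    exact Complex.continuous_ofReal.comp_continuousOn (continuousOn_const.sub H.continuousOn_ratio)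
  -- the decomposition `e^{iP} = τ' e^{iP} + (1 - τ') e^{iP}`
  have hsplit : (∫ x in c..β, E x) = (∫ x in c..β, (H.ratio x : ℂ) * E x)
      + ∫ x in c..β, ((1 - H.ratio x : ℝ) : ℂ) * E x := by
    rw [← intervalIntegral.integral_add hi1 (hi2 c H.cmem β hβI)]
    refine intervalIntegral.integral_congr fun x _ => ?_
    push_cast; ring
  -- ### (i) the main part
  have hmain : ‖(∫ x in c..β, (H.ratio x : ℂ) * E x) - Complex.exp (I * P c) * fresnelLim * ((Real.sqrt (P'' c))⁻¹ : ℝ)‖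
      ≤ 2 / (r * (β - c)) := by
    rw [show (fun x => (H.ratio x : ℂ) * E x) = fun x => (H.ratio x : ℂ) * Complex.exp (I * P x) from rfl,
      H.integral_ratio_mul_exp_eq, mul_assoc, ← mul_sub, norm_mul, hEn, one_mul]
    have hT : 0 < H.S β / P'' c := div_pos hSβ hL
    refine (norm_integral_quadratic_phase_right_sub_le hL hT).trans ?_
    rw [div_mul_cancel₀ _ hL.ne']
    exact div_le_div_of_nonneg_left (by norm_num) (by positivity) hSβ'
  -- ### (ii) the defect part, split at `x₁ = c + η₁`
  set η₁ : ℝ := min (1 / Real.sqrt r) (β - c) with hη₁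
  have hsr : 0 < Real.sqrt r := Real.sqrt_pos.2 hr
  have hη₁0 : 0 < η₁ := lt_min (by positivity) (sub_pos.2 hcβ)
  have hη₁1 : η₁ ≤ 1 / Real.sqrt r := min_le_left _ _
  have hη₁2 : η₁ ≤ β - c := min_le_right _ _
  set x₁ : ℝ := c + η₁ with hx₁
  have hcx₁ : c < x₁ := by rw [hx₁]; linarith
  have hx₁β : x₁ ≤ β := by rw [hx₁]; linarith
  have hx₁I : x₁ ∈ Icc c β := ⟨hcx₁.le, hx₁β⟩
  have hη₁sq : η₁ ^ 2 ≤ 1 / r := by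
    calc η₁ ^ 2 ≤ (1 / Real.sqrt r) ^ 2 := pow_le_pow_left₀ hη₁0.le hη₁1 2
      _ = 1 / r := by rw [div_pow, one_pow, Real.sq_sqrt hr.le]
  -- C1: the short piece
  have hC1 : ‖∫ x in c..x₁, ((1 - H.ratio x : ℝ) : ℂ) * E x‖ ≤ A / 3 * (lam3 / r ^ 2) := by
    have hb : ∀ x ∈ Set.uIoc c x₁, ‖((1 - H.ratio x : ℝ) : ℂ) * E x‖ ≤ A / 3 * (lam3 / r) * η₁ := by
      intro x hx
      rw [uIoc_of_le hcx₁.le] at hx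
      rw [norm_mul, hEn, mul_one, Complex.norm_real, Real.norm_eq_abs, abs_sub_comm]
      have := H.abs_ratio_sub_one_le' ⟨hx.1.le, hx.2.trans hx₁β⟩
      refine this.trans ?_
      have hK0 : 0 ≤ A / 3 * (lam3 / r) := by positivity
      exact mul_le_mul_of_nonneg_left (by rw [hx₁] at hx; linarith [hx.2]) hK0
    refine (intervalIntegral.norm_integral_le_of_norm_le_const hb).trans ?_
    rw [show x₁ - c = η₁ by rw [hx₁]; ring, abs_of_pos hη₁0]
    calc A / 3 * (lam3 / r) * η₁ * η₁ = A / 3 * (lam3 / r) * η₁ ^ 2 := by ring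
      _ ≤ A / 3 * (lam3 / r) * (1 / r) := by gcongr
      _ = A / 3 * (lam3 / r ^ 2) := by field_simp
  -- C2: the long piece, by parts
  have hC2 : ‖∫ x in x₁..β, ((1 - H.ratio x : ℝ) : ℂ) * E x‖
      ≤ 2 * (A / 3 * (lam3 / r ^ 2)) + 2 * A ^ 3 * (lam3 / r ^ 2) * Real.log ((β - c) / η₁) := by
    have hsub : Icc x₁ β ⊆ Ioc c β := fun x hx => ⟨hcx₁.trans_le hx.1, hx.2⟩
    have hsub' : Icc x₁ β ⊆ Icc c β := fun x hx => Ioc_subset_Icc_self (hsub hx)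
    have huI : uIcc x₁ β = Icc x₁ β := uIcc_of_le hx₁β
    -- `u = -I q`, `v = E`
    set qd : ℝ → ℝ := fun x => -(P'' x) / (P' x) ^ 2 + (P'' c * P' x / H.S x) / (H.S x) ^ 2 with hqd
    have hu : ∀ x ∈ uIcc x₁ β, HasDerivAt (fun x => -I * (H.q x : ℂ)) (-I * (qd x : ℂ)) x := by
      intro x hx; rw [huI] at hx
      exact ((H.hasDerivAt_q (hsub hx)).ofReal_comp).const_mul (-I)
    have hv : ∀ x ∈ uIcc x₁ β, HasDerivAt E (I * P' x * E x) x := by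
      intro x hx; rw [huI] at hx
      exact hasDerivAt_exp_I_mul (H.hP x (hsub' hx))
    have hqdc : ContinuousOn qd (Icc x₁ β) := by
      have hP'c := H.continuousOn_P'.mono hsub'
      have hP''c := H.continuousOn_P''.mono hsub'
      have hSc := H.continuousOn_S.mono hsub'
      have hP'0 : ∀ x ∈ Icc x₁ β, P' x ≠ 0 := fun x hx => (H.deriv_pos (hsub hx)).ne'
      have hS0 : ∀ x ∈ Icc x₁ β, H.S x ≠ 0 := fun x hx => (H.S_pos (hsub hx)).ne'
      rw [hqd]
      refine ContinuousOn.add (hP''c.neg.div (hP'c.pow 2) fun x hx => pow_ne_zero 2 (hP'0 x hx)) ?_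
      refine ContinuousOn.div ((continuousOn_const.mul hP'c).div hSc hS0) (hSc.pow 2)
        fun x hx => pow_ne_zero 2 (hS0 x hx)
    have hu' : IntervalIntegrable (fun x => -I * (qd x : ℂ)) volume x₁ β := by
      refine (ContinuousOn.intervalIntegrable ?_)
      rw [huI]
      exact continuousOn_const.mul (Complex.continuous_ofReal.comp_continuousOn hqdc)
    have hv' : IntervalIntegrable (fun x => I * P' x * E x) volume x₁ β := by
      refine (ContinuousOn.intervalIntegrable ?_)
      rw [huI]
      exact (continuousOn_const.mul (Complex.continuous_ofReal.comp_continuousOn (H.continuousOn_P'.mono hsub'))).mul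
        (hEc.mono hsub')
    have hparts := intervalIntegral.integral_mul_deriv_eq_deriv_mul hu hv hu' hv'
    -- the integrand `(1 - τ')E = (-I q) · (I P' E)` on `[x₁, β]`
    have hint : (∫ x in x₁..β, ((1 - H.ratio x : ℝ) : ℂ) * E x)
        = ∫ x in x₁..β, (-I * (H.q x : ℂ)) * (I * P' x * E x) := by
      refine intervalIntegral.integral_congr fun x hx => ?_
      rw [huI] at hx
      have hxc : c < x := hcx₁.trans_le hx.1
      have hP0 : P' x ≠ 0 := (H.deriv_pos (hsub hx)).ne'
      have hS0 : H.S x ≠ 0 := (H.S_pos (hsub hx)).ne'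
      have h1 : 1 - H.ratio x = H.q x * P' x := by
        rw [H.ratio_of_gt hxc, q_def]; field_simp
      rw [h1]
      push_cast
      have hre : (-I * (H.q x : ℂ)) * (I * P' x * E x) = -(I * I) * ((H.q x : ℂ) * P' x * E x) := by ring
      rw [hre, Complex.I_mul_I]
      ring
    rw [hint, hparts]
    -- bounds
    have hqβ := H.abs_q_le ⟨hcβ, le_rfl⟩
    have hqx₁ := H.abs_q_le ⟨hcx₁, hx₁β⟩
    have hbd1 : ‖-I * (H.q β : ℂ) * E β‖ ≤ A / 3 * (lam3 / r ^ 2) := by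
      rw [norm_mul, norm_mul, norm_neg, Complex.norm_I, one_mul, hEn, mul_one, Complex.norm_real, Real.norm_eq_abs]
      exact hqβ
    have hbd2 : ‖-I * (H.q x₁ : ℂ) * E x₁‖ ≤ A / 3 * (lam3 / r ^ 2) := by
      rw [norm_mul, norm_mul, norm_neg, Complex.norm_I, one_mul, hEn, mul_one, Complex.norm_real, Real.norm_eq_abs]
      exact hqx₁
    have hbd3 : ‖∫ x in x₁..β, -I * (qd x : ℂ) * E x‖ ≤ 2 * A ^ 3 * (lam3 / r ^ 2) * Real.log ((β - c) / η₁) := by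
      have hb : ∀ᵐ x : ℝ, x ∈ Ioc x₁ β → ‖-I * (qd x : ℂ) * E x‖ ≤ 2 * A ^ 3 * lam3 / r ^ 2 * (x - c)⁻¹ := by
        refine Eventually.of_forall fun x hx => ?_
        rw [norm_mul, norm_mul, norm_neg, Complex.norm_I, one_mul, hEn, mul_one, Complex.norm_real, Real.norm_eq_abs]
        have := H.abs_qderiv_le ⟨hcx₁.trans hx.1, hx.2⟩
        rw [hqd]
        refine this.trans (le_of_eq ?_)
        field_simp
      have hgi : IntervalIntegrable (fun x => 2 * A ^ 3 * lam3 / r ^ 2 * (x - c)⁻¹) volume x₁ β := by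
        refine ContinuousOn.intervalIntegrable ?_
        rw [huI]
        refine continuousOn_const.mul (ContinuousOn.inv₀ (continuousOn_id.sub continuousOn_const) ?_)
        intro x hx; exact (sub_pos.2 (hcx₁.trans_le hx.1)).ne'
      refine (intervalIntegral.norm_integral_le_of_norm_le hx₁β hb hgi).trans (le_of_eq ?_)
      rw [intervalIntegral.integral_const_mul, intervalIntegral.integral_comp_sub_right (fun x => x⁻¹) c,
        integral_inv_of_pos (by linarith) (by linarith)]
      rw [show x₁ - c = η₁ by rw [hx₁]; ring]
      ring
    calc ‖-I * (H.q β : ℂ) * E β - -I * (H.q x₁ : ℂ) * E x₁ - ∫ x in x₁..β, -I * (qd x : ℂ) * E x‖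
        ≤ ‖-I * (H.q β : ℂ) * E β‖ + ‖-I * (H.q x₁ : ℂ) * E x₁‖ + ‖∫ x in x₁..β, -I * (qd x : ℂ) * E x‖ := by
          have h1 := norm_sub_le (-I * (H.q β : ℂ) * E β - -I * (H.q x₁ : ℂ) * E x₁) (∫ x in x₁..β, -I * (qd x : ℂ) * E x)
          have h2 := norm_sub_le (-I * (H.q β : ℂ) * E β) (-I * (H.q x₁ : ℂ) * E x₁)
          linarith
      _ ≤ A / 3 * (lam3 / r ^ 2) + A / 3 * (lam3 / r ^ 2) + 2 * A ^ 3 * (lam3 / r ^ 2) * Real.log ((β - c) / η₁) := by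
          gcongr
      _ = 2 * (A / 3 * (lam3 / r ^ 2)) + 2 * A ^ 3 * (lam3 / r ^ 2) * Real.log ((β - c) / η₁) := by ring
  -- the logarithm
  have hlog : Real.log ((β - c) / η₁) ≤ Real.log (1 + (β - c) * Real.sqrt r) := by
    refine Real.log_le_log (div_pos (sub_pos.2 hcβ) hη₁0) ?_
    rw [div_le_iff₀ hη₁0, hη₁]
    rcases le_total (1 / Real.sqrt r) (β - c) with h | h
    · rw [min_eq_left h]
      have : (1 + (β - c) * Real.sqrt r) * (1 / Real.sqrt r) = 1 / Real.sqrt r + (β - c) := by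
        field_simp
      rw [this]
      have : 0 < 1 / Real.sqrt r := by positivity
      linarith
    · rw [min_eq_right h]
      nlinarith [mul_pos (mul_pos (sub_pos.2 hcβ) hsr) (sub_pos.2 hcβ)]
  have hlog0 : 0 ≤ Real.log ((β - c) / η₁) := Real.log_nonneg (by rw [le_div_iff₀ hη₁0]; linarith)
  -- ### assembly
  have hdef : ‖∫ x in c..β, ((1 - H.ratio x : ℝ) : ℂ) * E x‖
      ≤ A * (lam3 / r ^ 2) + 2 * A ^ 3 * (lam3 / r ^ 2) * Real.log (1 + (β - c) * Real.sqrt r) := by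
    rw [← intervalIntegral.integral_add_adjacent_intervals (hi2 c H.cmem x₁ hx₁I) (hi2 x₁ hx₁I β hβI)]
    refine (norm_add_le _ _).trans ?_
    have : A / 3 * (lam3 / r ^ 2) + (2 * (A / 3 * (lam3 / r ^ 2)) + 2 * A ^ 3 * (lam3 / r ^ 2) * Real.log ((β - c) / η₁))
        ≤ A * (lam3 / r ^ 2) + 2 * A ^ 3 * (lam3 / r ^ 2) * Real.log (1 + (β - c) * Real.sqrt r) := by
      have h0 : 0 ≤ 2 * A ^ 3 * (lam3 / r ^ 2) := by positivity
      nlinarith [mul_le_mul_of_nonneg_left hlog h0]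
    linarith [hC1, hC2]
  have hA3 : A * (lam3 / r ^ 2) ≤ 2 * A ^ 3 * (lam3 / r ^ 2) := by
    have : A ≤ 2 * A ^ 3 := by nlinarith [sq_nonneg A, hA1]
    exact mul_le_mul_of_nonneg_right this (by positivity)
  calc ‖(∫ x in c..β, E x) - Complex.exp (I * P c) * fresnelLim * ((Real.sqrt (P'' c))⁻¹ : ℝ)‖
      = ‖((∫ x in c..β, (H.ratio x : ℂ) * E x) - Complex.exp (I * P c) * fresnelLim * ((Real.sqrt (P'' c))⁻¹ : ℝ))
          + ∫ x in c..β, ((1 - H.ratio x : ℝ) : ℂ) * E x‖ := by rw [hsplit]; ring_nf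
    _ ≤ 2 / (r * (β - c)) + (A * (lam3 / r ^ 2) + 2 * A ^ 3 * (lam3 / r ^ 2) * Real.log (1 + (β - c) * Real.sqrt r)) :=
        (norm_add_le _ _).trans (add_le_add hmain hdef)
    _ ≤ 2 / (r * (β - c)) + 2 * A ^ 3 * (lam3 / r ^ 2) * (1 + Real.log (1 + (β - c) * Real.sqrt r)) := by
        nlinarith [hA3]

end LogStatPhaseHyp


/-! ### The two-sided statements -/

/-- **Sharp stationary phase** (convex case).  Let `P, P', P''` be differentiable on `[α, β]`
(`HasDerivAt`, derivatives `P', P'', P'''`), `r ≤ P'' ≤ Ar`, `|P'''| ≤ λ₃` on `[α, β]` (`r > 0`, `A ≥ 1`), and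
`P'(c) = 0` with `α < c < β`.  Then
`‖∫_α^β e^{iP(x)} dx - 𝔣 e^{iP(c)} P''(c)^{-1/2}‖`
`  ≤ 2/(r(c-α)) + 2/(r(β-c)) + 2A³(λ₃/r²)(2 + log(1 + (c-α)√r) + log(1 + (β-c)√r))`
(`𝔣 = fresnelC = ∫_{-∞}^{∞} e^{iu²/2} du`). [cite: GrahamKolesnik1991, Lemma 3.4] [cite: Titchmarsh1986, Lemma 4.6] -/
theorem stationaryPhase_log {P P' P'' P''' : ℝ → ℝ} {α β c r A lam3 : ℝ} (hαc : α < c) (hcβ : c < β)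
    (hr : 0 < r) (hA : 1 ≤ A)
    (hP : ∀ x ∈ Icc α β, HasDerivAt P (P' x) x) (hP' : ∀ x ∈ Icc α β, HasDerivAt P' (P'' x) x)
    (hP'' : ∀ x ∈ Icc α β, HasDerivAt P'' (P''' x) x)
    (h2 : ∀ x ∈ Icc α β, r ≤ P'' x ∧ P'' x ≤ A * r) (h3 : ∀ x ∈ Icc α β, |P''' x| ≤ lam3) (hc : P' c = 0) :
    ‖(∫ x in α..β, Complex.exp (I * P x)) - fresnelC * Complex.exp (I * P c) * ((Real.sqrt (P'' c))⁻¹ : ℝ)‖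
      ≤ 2 / (r * (c - α)) + 2 / (r * (β - c))
        + 2 * A ^ 3 * (lam3 / r ^ 2) *
          (2 + Real.log (1 + (c - α) * Real.sqrt r) + Real.log (1 + (β - c) * Real.sqrt r)) := by
  have hsubR : Icc c β ⊆ Icc α β := Icc_subset_Icc hαc.le le_rfl
  -- ### right half
  have HR : LogStatPhaseHyp P P' P'' P''' c β r A lam3 :=
    ⟨hcβ, hr, hA, fun x hx => hP x (hsubR hx), fun x hx => hP' x (hsubR hx), fun x hx => hP'' x (hsubR hx),
      fun x hx => h2 x (hsubR hx), fun x hx => h3 x (hsubR hx), hc⟩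
  have hright := HR.norm_integral_sub_main_le
  -- ### left half, by the reflection `y ↦ 2c - y`
  have hrefl : ∀ y ∈ Icc c (2 * c - α), 2 * c - y ∈ Icc α β :=
    fun y hy => ⟨by linarith [hy.2], by linarith [hy.1]⟩
  have hd : ∀ y : ℝ, HasDerivAt (fun y : ℝ => 2 * c - y) (-1) y := fun y => by
    simpa using (hasDerivAt_id y).const_sub (2 * c)
  have hQ : ∀ y ∈ Icc c (2 * c - α), HasDerivAt (fun y => P (2 * c - y)) (-P' (2 * c - y)) y := by
    intro y hy
    have h := (hP (2 * c - y) (hrefl y hy)).comp y (hd y)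
    exact h.congr_deriv (by ring)
  have hQ' : ∀ y ∈ Icc c (2 * c - α), HasDerivAt (fun y => -P' (2 * c - y)) (P'' (2 * c - y)) y := by
    intro y hy
    have h := ((hP' (2 * c - y) (hrefl y hy)).comp y (hd y)).neg
    exact h.congr_deriv (by ring)
  have hQ'' : ∀ y ∈ Icc c (2 * c - α), HasDerivAt (fun y => P'' (2 * c - y)) (-P''' (2 * c - y)) y := by
    intro y hy
    have h := (hP'' (2 * c - y) (hrefl y hy)).comp y (hd y)
    exact h.congr_deriv (by ring)
  have HL : LogStatPhaseHyp (fun y => P (2 * c - y)) (fun y => -P' (2 * c - y)) (fun y => P'' (2 * c - y))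
      (fun y => -P''' (2 * c - y)) c (2 * c - α) r A lam3 :=
    ⟨by linarith, hr, hA, hQ, hQ', hQ'', fun y hy => h2 _ (hrefl y hy),
      fun y hy => by rw [abs_neg]; exact h3 _ (hrefl y hy), by rw [show 2 * c - c = c by ring, hc, neg_zero]⟩
  have hleft := HL.norm_integral_sub_main_le
  have hsub : (∫ y in c..(2 * c - α), Complex.exp (I * ((P (2 * c - y) : ℝ) : ℂ)))
      = ∫ x in α..c, Complex.exp (I * P x) := by
    rw [intervalIntegral.integral_comp_sub_left (fun x => Complex.exp (I * P x)) (2 * c)]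
    congr 1 <;> ring
  simp only [hsub] at hleft
  rw [show 2 * c - c = c by ring, show 2 * c - α - c = c - α by ring] at hleft
  -- ### assembly
  have hab : IntervalIntegrable (fun x => Complex.exp (I * P x)) volume α c :=
    ((continuousOn_exp_I_mul hP).mono (by rw [uIcc_of_le hαc.le]; exact Icc_subset_Icc le_rfl hcβ.le)).intervalIntegrable
  have hbc : IntervalIntegrable (fun x => Complex.exp (I * P x)) volume c β :=
    ((continuousOn_exp_I_mul hP).mono (by rw [uIcc_of_le hcβ.le]; exact hsubR)).intervalIntegrable
  rw [← intervalIntegral.integral_add_adjacent_intervals hab hbc]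
  have hC : fresnelC * Complex.exp (I * P c) * ((Real.sqrt (P'' c))⁻¹ : ℝ)
      = Complex.exp (I * P c) * fresnelLim * ((Real.sqrt (P'' c))⁻¹ : ℝ)
        + Complex.exp (I * P c) * fresnelLim * ((Real.sqrt (P'' c))⁻¹ : ℝ) := by
    rw [fresnelC]; ring
  rw [hC]
  calc ‖(∫ x in α..c, Complex.exp (I * P x)) + (∫ x in c..β, Complex.exp (I * P x))
        - (Complex.exp (I * P c) * fresnelLim * ((Real.sqrt (P'' c))⁻¹ : ℝ)
          + Complex.exp (I * P c) * fresnelLim * ((Real.sqrt (P'' c))⁻¹ : ℝ))‖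
      = ‖((∫ x in α..c, Complex.exp (I * P x)) - Complex.exp (I * P c) * fresnelLim * ((Real.sqrt (P'' c))⁻¹ : ℝ))
        + ((∫ x in c..β, Complex.exp (I * P x)) - Complex.exp (I * P c) * fresnelLim * ((Real.sqrt (P'' c))⁻¹ : ℝ))‖ := by
        ring_nf
    _ ≤ (2 / (r * (c - α)) + 2 * A ^ 3 * (lam3 / r ^ 2) * (1 + Real.log (1 + (c - α) * Real.sqrt r)))
        + (2 / (r * (β - c)) + 2 * A ^ 3 * (lam3 / r ^ 2) * (1 + Real.log (1 + (β - c) * Real.sqrt r))) :=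
        (norm_add_le _ _).trans (add_le_add hleft hright)
    _ = _ := by ring

/-- **Sharp stationary phase, concave case** (apply the convex case to `-P` and conjugate): with
`r ≤ -P'' ≤ Ar`, `|P'''| ≤ λ₃`, `P'(c) = 0`, `α < c < β`,
`‖∫_α^β e^{iP(x)} dx - conj(𝔣) e^{iP(c)} |P''(c)|^{-1/2}‖`
`  ≤ 2/(r(c-α)) + 2/(r(β-c)) + 2A³(λ₃/r²)(2 + log(1 + (c-α)√r) + log(1 + (β-c)√r))`.
[cite: GrahamKolesnik1991, Lemma 3.4] [cite: Titchmarsh1986, Lemma 4.6] -/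
theorem stationaryPhase_log_neg {P P' P'' P''' : ℝ → ℝ} {α β c r A lam3 : ℝ} (hαc : α < c) (hcβ : c < β)
    (hr : 0 < r) (hA : 1 ≤ A)
    (hP : ∀ x ∈ Icc α β, HasDerivAt P (P' x) x) (hP' : ∀ x ∈ Icc α β, HasDerivAt P' (P'' x) x)
    (hP'' : ∀ x ∈ Icc α β, HasDerivAt P'' (P''' x) x)
    (h2 : ∀ x ∈ Icc α β, r ≤ -P'' x ∧ -P'' x ≤ A * r) (h3 : ∀ x ∈ Icc α β, |P''' x| ≤ lam3) (hc : P' c = 0) :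
    ‖(∫ x in α..β, Complex.exp (I * P x))
        - (starRingEnd ℂ) fresnelC * Complex.exp (I * P c) * ((Real.sqrt (-P'' c))⁻¹ : ℝ)‖
      ≤ 2 / (r * (c - α)) + 2 / (r * (β - c))
        + 2 * A ^ 3 * (lam3 / r ^ 2) *
          (2 + Real.log (1 + (c - α) * Real.sqrt r) + Real.log (1 + (β - c) * Real.sqrt r)) := by
  have hab : α ≤ β := (hαc.trans hcβ).le
  have key := stationaryPhase_log (P := fun x => -P x) (P' := fun x => -P' x) (P'' := fun x => -P'' x)
    (P''' := fun x => -P''' x) hαc hcβ hr hA (fun x hx => (hP x hx).neg)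
    (fun x hx => (hP' x hx).neg) (fun x hx => (hP'' x hx).neg) h2
    (fun x hx => by rw [abs_neg]; exact h3 x hx) (by simp [hc])
  have h1 : (starRingEnd ℂ) (∫ x in α..β, Complex.exp (I * ((-P x : ℝ) : ℂ)))
      = ∫ x in α..β, Complex.exp (I * P x) := by
    rw [intervalIntegral.integral_of_le hab, intervalIntegral.integral_of_le hab, ← integral_conj]
    refine setIntegral_congr_fun measurableSet_Ioc fun x _ => ?_
    rw [← Complex.exp_conj, map_mul, Complex.conj_I, Complex.conj_ofReal]
    push_cast
    ring_nf
  have h2c : (starRingEnd ℂ) (fresnelC * Complex.exp (I * ((-P c : ℝ) : ℂ))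
        * (((Real.sqrt (-P'' c))⁻¹ : ℝ) : ℂ))
      = (starRingEnd ℂ) fresnelC * Complex.exp (I * P c) * ((Real.sqrt (-P'' c))⁻¹ : ℝ) := by
    rw [map_mul, map_mul, Complex.conj_ofReal, ← Complex.exp_conj, map_mul, Complex.conj_I,
      Complex.conj_ofReal]
    push_cast
    ring_nf
  rw [← h1, ← h2c, ← map_sub, RCLike.norm_conj]
  exact key

end Literature.Analysis.Fourier

end
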